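import Literature.AnabelianGeometry.SemiGraphs.TemperedReconstructionCompatProofsAt
import Literature.AnabelianGeometry.SemiGraphs.TemperedReconstructionR2bCompatProofsAt
import Literature.AnabelianGeometry.SemiGraphs.TemperedReconstructionR0CompatProofsAt
import Literature.AnabelianGeometry.SemiGraphs.TemperedCompactInVerticialFinite
import HarnessLib

/-!
# [SemiAnbd] Cor. 3.9 under the compatible reading of Def. 3.8 — the capstones AT ONE PAIR OF GRAPHS
# (φ2 twin of `TemperedReconstructionBaseUniquenessProofs`, proof-only)

Mochizuki, *Semi-graphs of anabelioids*, Publ. RIMS **42** (2006), §3, Cor. 3.9, manuscript pp. 42–43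
[cite: MochizukiSemiAnbd2006, Cor 3.9 pp.42-43]: "a natural bijective correspondence between locally open
morphisms … and quasi-geometric morphisms"; "φ arises from a morphism of graphs of anabelioids which [again by
Theorem 3.7, (iii), (iv)] is manifestly unique".

PROOF-ONLY companion (cell abc-iut, layer L3, L3-lead α107 «CIV-REBIND-L3», CompactInVerticial half; seat
abc-iut-w6-d120; label [mechanical rebind after p442260/p443103; not a cone member]) of
`TemperedReconstructionBaseUniquenessProofs.lean`.  Of the consumers there of the ∀-countable named fact
Thm 3.7 (iii) `CompactInVerticial` (FACT-LIST F-1732; ∀-countable reading refuted at universe `0`,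
`ProfiniteSemiGraph.not_compactInVerticial`):

* `compatible_base_eq`, `base_eq_of_induces`, `base_eq_of_induces_of_compactInVerticial` need NO twin — the
  same file proves them UNCONDITIONALLY (`base_eq_of_compatV`, `base_eq_of_induces'`, the branch maps
  determining the edge map);
* the two CAPSTONES `cor39Compat_of_compactInVerticial` / `cor39Compat_bijection_of_compactInVerticial`
  conclude the ∀-statement `Cor39Compat`; this file states their BODIES at one pair `(𝒢, ℋ)` with Thm 3.7
  (iii) AT `𝒢` and AT `ℋ` and the step R3 at the pair as the only binders
  (`cor39CompatAt_of_compactInVerticialAt`, `cor39Compat_bijectionAt_of_compactInVerticialAt`; inputs BY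
  NAME: the per-pair assembly `cor39Compat_of_thm37_i_iiiAt`, R2′ per pair
  `quasiGeometricGraphDataCompatAt_of_compactInVerticialAt`, (a′) per pair
  `isCompatiblyQuasiGeometric_of_compatAt`, uniqueness `base_eq_of_induces'`), and DISCHARGES Thm 3.7 (iii)
  at FINITE graphs for the bijection form (`cor39Compat_bijectionAt_of_finiteGraph`, via
  `compactInVerticialAt_of_finiteGraph`, p431007; print p. 41 "since the semi-graphs `𝔾_j` are all finite") —
  so that at a pair of finite graphs Cor. 3.9 under the compatible reading, WITH full uniqueness of the
  underlying morphism of semi-graphs, is a kernel theorem MODULO THE ONE STEP R3 (`Hom.Induces` from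
  compatibility, the temperoid-level existence half) at that pair.  (The finite forms of the plain capstone
  and of clause (a′) are already in the tree: `cor39CompatAt_of_finiteGraph`, `cor39_a_compat_of_finiteGraph`,
  `TemperedReconstructionCor39FactsFinite.lean`.)

Original untouched; nothing here asserts Thm 3.7 (iii) for an infinite `𝔾`; nothing here takes a side on
[IUTchIII] Cor. 3.12; typed ≠ discharged.
-/

namespace Literature.AnabelianGeometry.SemiGraphs

namespace ProfiniteSemiGraph

universe u

variable {𝒢 ℋ : ProfiniteSemiGraph.{u}}

/-! ### The capstones at one pair, modulo Thm 3.7 (iii) at `𝒢`, `ℋ` and R3 at the pair -/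

/-- **`Cor39Compat` AT the pair `(𝒢, ℋ)` modulo Thm 3.7 (iii) at `𝒢`, at `ℋ` and R3 at the pair** (φ2 twin
of `cor39Compat_of_compactInVerticial`): (a) a homomorphism induced by a locally open `F : G → H` is
quasi-geometric; (b) a compatibly quasi-geometric `φ` is induced by a locally open `F`, unique on vertices and
edges.  Thm 3.7 (i) is `verticialInjective_holds`; R2′ at the pair is the kernel theorem
`quasiGeometricGraphDataCompatAt_of_compactInVerticialAt`. [cite: MochizukiSemiAnbd2006, Cor 3.9 pp.42-43] -/
theorem cor39CompatAt_of_compactInVerticialAt (h𝒢iii : CompactInVerticialAt 𝒢)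
    (hℋiii : CompactInVerticialAt ℋ) (h𝒢 : Cor39Hypotheses 𝒢) (hℋ : Cor39Hypotheses ℋ)
    (c𝒢 : TemperedPiChart 𝒢) (cℋ : TemperedPiChart ℋ)
    (hR3 : ∀ (F : Hom 𝒢 ℋ) (φ : c𝒢.G →ₜ* cℋ.G), F.IsLocallyOpen → F.CompatV c𝒢 cℋ φ →
      F.CompatE c𝒢 cℋ φ → F.Induces c𝒢 cℋ φ) :
    (∀ (F : Hom 𝒢 ℋ), F.IsLocallyOpen → ∀ φ : c𝒢.G →ₜ* cℋ.G, F.Induces c𝒢 cℋ φ →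
        IsQuasiGeometric φ) ∧
      ∀ φ : c𝒢.G →ₜ* cℋ.G, IsCompatiblyQuasiGeometric φ →
        ∃ F : Hom 𝒢 ℋ, F.IsLocallyOpen ∧ F.Induces c𝒢 cℋ φ ∧
          ∀ F' : Hom 𝒢 ℋ, F'.IsLocallyOpen → F'.Induces c𝒢 cℋ φ →
            F'.base.vertexMap = F.base.vertexMap ∧ F'.base.edgeMap = F.base.edgeMap :=
  cor39Compat_of_thm37_i_iiiAt verticialInjective_holds h𝒢iii hℋiii h𝒢 hℋ c𝒢 cℋ
    (fun φ hφ => quasiGeometricGraphDataCompatAt_of_compactInVerticialAt h𝒢iii hℋiii h𝒢 hℋ c𝒢 cℋ φ hφ)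
    hR3

/-- **Cor. 3.9 as a BIJECTION under the compatible reading, AT the pair `(𝒢, ℋ)`** (φ2 twin of
`cor39Compat_bijection_of_compactInVerticial`), modulo Thm 3.7 (iii) at `𝒢`, at `ℋ` and R3 at the pair:
(a′) a homomorphism induced by a locally open `F : G → H` is COMPATIBLY quasi-geometric
(`isCompatiblyQuasiGeometric_of_compatAt`); (b′) a compatibly quasi-geometric `φ` is induced by a locally open
`F`, and the WHOLE underlying morphism of semi-graphs of any such `F` (vertex, edge and branch maps) is
uniquely determined — the uniqueness being the UNCONDITIONAL `base_eq_of_induces'`.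
[cite: MochizukiSemiAnbd2006, Cor 3.9 pp.42-43] -/
theorem cor39Compat_bijectionAt_of_compactInVerticialAt (h𝒢iii : CompactInVerticialAt 𝒢)
    (hℋiii : CompactInVerticialAt ℋ) (h𝒢 : Cor39Hypotheses 𝒢) (hℋ : Cor39Hypotheses ℋ)
    (c𝒢 : TemperedPiChart 𝒢) (cℋ : TemperedPiChart ℋ)
    (hR3 : ∀ (F : Hom 𝒢 ℋ) (φ : c𝒢.G →ₜ* cℋ.G), F.IsLocallyOpen → F.CompatV c𝒢 cℋ φ →
      F.CompatE c𝒢 cℋ φ → F.Induces c𝒢 cℋ φ) :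
    (∀ F : Hom 𝒢 ℋ, F.IsLocallyOpen → ∀ φ : c𝒢.G →ₜ* cℋ.G, F.Induces c𝒢 cℋ φ →
        IsCompatiblyQuasiGeometric φ) ∧
      ∀ φ : c𝒢.G →ₜ* cℋ.G, IsCompatiblyQuasiGeometric φ →
        ∃ F : Hom 𝒢 ℋ, F.IsLocallyOpen ∧ F.Induces c𝒢 cℋ φ ∧
          ∀ F' : Hom 𝒢 ℋ, F'.IsLocallyOpen → F'.Induces c𝒢 cℋ φ → F'.base = F.base := by
  refine ⟨fun F hF φ hind => ?_, fun φ hφ => ?_⟩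
  · obtain ⟨hV, hE⟩ := InducesCompatible_holds 𝒢 ℋ h𝒢 hℋ c𝒢 cℋ F φ hind
    exact isCompatiblyQuasiGeometric_of_compatAt verticialInjective_holds verticialDistinct_holds h𝒢iii
      (maximalCompactIffVerticialAt_of_compactInVerticialAt h𝒢iii)
      (maximalCompactIffVerticialAt_of_compactInVerticialAt hℋiii) h𝒢 hℋ c𝒢 cℋ F φ hF hV hE
  · obtain ⟨F, hF, hV, hE⟩ :=
      quasiGeometricGraphDataCompatAt_of_compactInVerticialAt h𝒢iii hℋiii h𝒢 hℋ c𝒢 cℋ φ hφ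
    have hind : F.Induces c𝒢 cℋ φ := hR3 F φ hF hV hE
    exact ⟨F, hF, hind, fun F' hF' hind' => (base_eq_of_induces' h𝒢 hℋ c𝒢 cℋ hF hF' hind hind').symm⟩

/-! ### Discharged at pairs of FINITE graphs (print p. 41: "the semi-graphs `𝔾_j` are all finite") -/

/-- **Cor. 3.9 as a bijection under the compatible reading at a pair of FINITE graphs, modulo R3 at the pair
alone** (full uniqueness of the underlying morphism of semi-graphs). [cite: MochizukiSemiAnbd2006, Cor 3.9 pp.42-43] -/
theorem cor39Compat_bijectionAt_of_finiteGraph [Finite 𝒢.graph.Vertex] [Finite 𝒢.graph.Edge]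
    [Finite ℋ.graph.Vertex] [Finite ℋ.graph.Edge] (h𝒢 : Cor39Hypotheses 𝒢) (hℋ : Cor39Hypotheses ℋ)
    (c𝒢 : TemperedPiChart 𝒢) (cℋ : TemperedPiChart ℋ)
    (hR3 : ∀ (F : Hom 𝒢 ℋ) (φ : c𝒢.G →ₜ* cℋ.G), F.IsLocallyOpen → F.CompatV c𝒢 cℋ φ →
      F.CompatE c𝒢 cℋ φ → F.Induces c𝒢 cℋ φ) :
    (∀ F : Hom 𝒢 ℋ, F.IsLocallyOpen → ∀ φ : c𝒢.G →ₜ* cℋ.G, F.Induces c𝒢 cℋ φ →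
        IsCompatiblyQuasiGeometric φ) ∧
      ∀ φ : c𝒢.G →ₜ* cℋ.G, IsCompatiblyQuasiGeometric φ →
        ∃ F : Hom 𝒢 ℋ, F.IsLocallyOpen ∧ F.Induces c𝒢 cℋ φ ∧
          ∀ F' : Hom 𝒢 ℋ, F'.IsLocallyOpen → F'.Induces c𝒢 cℋ φ → F'.base = F.base :=
  cor39Compat_bijectionAt_of_compactInVerticialAt compactInVerticialAt_of_finiteGraph
    compactInVerticialAt_of_finiteGraph h𝒢 hℋ c𝒢 cℋ hR3

end ProfiniteSemiGraph

end Literature.AnabelianGeometry.SemiGraphs
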